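/-
Copyright (c) 2026 the pub-hodgecm-mathlib formalisation cell (harness21).  Prover seat hodgecm-mathlib-K2E3-p03 (g2), Track B «K2-LIT» ∕ h413, road J ∕ R3 brick
«R3b-ram-1» (dealer K2E3-plan (g2) (D5), road owner K2E3-p15 (g2)): the anisotropic unitary plane `U(⟨1, −ξ⟩)` with `ξ` a NON-NORM UNIT — every element is integral.
-/
import Literature.NumberTheory.Automorphic.UnitaryAnisotropicPlaneValuations   -- ★ R3b-1 (K2E3-p15): `anisoPlane_entry_relations`, `valued_le_one_of_sq_le_one` (the `ord ξ` odd twin)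
import HarnessLib

/-!
# The anisotropic unitary plane `U(σ, ⟨1, −ξ⟩)(K)` with `ξ` a NON-NORM UNIT (`|ξ| = 1`, `|σu·u − ξ| = 1` for every unit `u`): EVERY element is an integral matrix,
# `|g_{ij}| ≤ 1`, and `|σx·x − ξ·σy·y| = max(|x|², |y|²)` (Rogawski 1990 §3.8 p. 33; Platonov–Rapinchuk 1994 §3.3; Weil 1982 Ch. II §2.2)

Topic `NumberTheory/Automorphic`; namespace `Literature.NumberTheory.Automorphic.UnitaryGroup` (home of ★ R3b-1 `UnitaryAnisotropicPlaneValuations`).  THEOREMS ONLY (no definition,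
no instance, no notation, no named fact, no `sorry`); kernel lane `--kind proof --supports stmt-HodgeConjecture-24833` (count-neutral).  Cell `pub/hodgecm-mathlib`, crux H413 =
`stmt-HodgeConjecture-24833`, Track B E3∕E4 junction ‹S› `sig_K2E3SingularTransferSigned`, ROAD J, letter **J3** `sig_K2E3CompatibleMeasureEPIdentityRankOne` (v2; road owner
K2E3-p15 (g2)); (r)-class = ramified `v ∤ 2` (REPORT-R3ram-1∕2, K2E3-p03 (g2)); brick **R3b-ram-1** — the (r)-twin of ★ R3b-1: at a TAMELY RAMIFIED CM place the anisotropic plane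
is `⟨1, −ξ⟩` with `ξ` a UNIT whose residue is a NON-SQUARE (unit norms are squares mod `𝔭_w` since `σ ≡ id` on the residue field), i.e. `|σu·u − ξ| = 1` for every unit `u` — the
hypothesis `hξN` below; the CM instantiation (★ `isSquare_residue_toPlace_iff_of_ramified`, ★ `RamifiedPlaceUnitNorms`) is the sequel's one-liner.

THE MATHEMATICS.  `K` a field valued in `ℤᵐ⁰`, `σ` isometric, `|ξ| = 1` with `hξN : ∀ u, |u| = 1 → |σu·u − ξ| = 1`.  Then (§1) **`|σx·x − ξ·σy·y| = max(|x|², |y|²)`** for all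
`x, y`: if `|x| ≠ |y|` this is the ultrametric equality; if `|x| = |y| ≠ 0`, `σx·x − ξσy·y = σy·y·(σu·u − ξ)` with the unit `u = x∕y`, of valuation `|y|²·1`.  Hence (§2), from the
entry relations `σa·a − ξσc·c = 1` and `σb·b − ξσd·d = −ξ` of ★ `anisoPlane_entry_relations`: `max(|a|²,|c|²) = 1 = max(|b|²,|d|²)`, so **`|a|, |b|, |c|, |d| ≤ 1`**:
`U(⟨1,−ξ⟩)(K) ⊆ GL₂(𝒪_K)` — the compact group is its own integral model (its reduction lands in `O(⟨1, −ξ̄⟩)(k)`, the count is R3b-ram-2).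
* §1 `valued_normSub_eq_max_of_unit`.
* §2 **`anisoPlane_valued_le_of_unit`** (`|g_{ij}| ≤ 1`), `anisoPlane_inv_valued_le_of_unit` (the same for `g⁻¹ ∈ U`).
HONEST LABEL: count-neutral algebra; HC_CM is proved only modulo the 7 printed citations (2 remaining named inputs: hLiu418 = `stmt-HodgeConjecture-24832`, h413 =
`stmt-HodgeConjecture-24833`) until rung 0 closes; J3 is NOT proved here.

## References
* [Rogawski1990] J. D. Rogawski, *Automorphic Representations of Unitary Groups in Three Variables*, Ann. of Math. Stud. 123 (1990), §3.8 p. 33 (the planes `H′_ξ`; anisotropic iff `ξ ∉ NE*`).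
* [PlatonovRapinchuk1994] V. Platonov, A. Rapinchuk, *Algebraic Groups and Number Theory* (1994), §3.3 (compact groups of anisotropic forms are their own integral points).
* [Weil1982] A. Weil, *Adeles and Algebraic Groups*, Progress in Math. 23 (1982), Ch. II §2.2.
-/

set_option autoImplicit false

noncomputable section

open scoped Matrix MatrixGroups
open Matrix WithZero

namespace Literature.NumberTheory.Automorphic

namespace UnitaryGroup

section Parity

variable {K : Type*} [Field K] [Valued K ℤᵐ⁰] (σ : K →+* K) (hvσ : ∀ x, Valued.v (σ x) = Valued.v x) {ξ : K}
  (hξ1 : Valued.v ξ = 1) (hξN : ∀ u : K, Valued.v u = 1 → Valued.v (σ u * u - ξ) = 1)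

include hvσ hξ1 hξN in
/-- **NO CANCELLATION AGAINST A NON-NORM UNIT**: `|σx·x − ξ·σy·y| = max(|x|², |y|²)` when `|ξ| = 1` and `|σu·u − ξ| = 1` for every unit `u` (`ξ` is not a norm residue).
[cite: Rogawski1990, §3.8 p. 33] [cite: PlatonovRapinchuk1994, §3.3] -/
theorem valued_normSub_eq_max_of_unit (x y : K) :
    Valued.v (σ x * x - ξ * (σ y * y)) = max (Valued.v x ^ 2) (Valued.v y ^ 2) := by
  have hNx : Valued.v (σ x * x) = Valued.v x ^ 2 := by rw [map_mul, hvσ, sq]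
  have hNy : Valued.v (ξ * (σ y * y)) = Valued.v y ^ 2 := by rw [map_mul, map_mul, hξ1, hvσ, one_mul, sq]
  rcases eq_or_ne y 0 with hy | hy
  · rw [hy, mul_zero, mul_zero, sub_zero, map_zero, zero_pow two_ne_zero, hNx]
    exact (max_eq_left zero_le).symm
  by_cases hxy : Valued.v x = Valued.v y
  · -- `x = u·y` with `u` a unit: `σx·x − ξσy·y = σy·y·(σu·u − ξ)`
    have hu : Valued.v (x / y) = 1 := by rw [map_div₀, hxy, div_self ((Valuation.ne_zero_iff _).2 hy)]
    have he : σ x * x - ξ * (σ y * y) = σ y * y * (σ (x / y) * (x / y) - ξ) := by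
      have hσy : σ y ≠ 0 := (map_ne_zero σ).2 hy
      rw [map_div₀]
      field_simp
    rw [he, map_mul, map_mul, hvσ, hξN _ hu, mul_one, ← sq, ← hxy, max_self]
  · -- distinct valuations: ultrametric equality
    have hsq : Valued.v x ^ 2 ≠ Valued.v y ^ 2 := fun h =>
      hxy (le_antisymm ((pow_le_pow_iff_left₀ zero_le zero_le two_ne_zero).1 h.le) ((pow_le_pow_iff_left₀ zero_le zero_le two_ne_zero).1 h.ge))
    have hne : Valued.v (σ x * x) ≠ Valued.v (-(ξ * (σ y * y))) := by rwa [Valuation.map_neg, hNx, hNy]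
    rw [sub_eq_add_neg, Valuation.map_add_of_distinct_val _ hne, Valuation.map_neg, hNx, hNy]

end Parity

/-! ## §2 Every element of `U(σ, ⟨1, −ξ⟩)(K)` is integral -/

section Entries

variable {K : Type*} [Field K] [Valued K ℤᵐ⁰] (σ : K →+* K) (hvσ : ∀ x, Valued.v (σ x) = Valued.v x) {ξ : K}
  (hξ1 : Valued.v ξ = 1) (hξN : ∀ u : K, Valued.v u = 1 → Valued.v (σ u * u - ξ) = 1)

include hvσ hξ1 hξN in
/-- **EVERY ELEMENT OF THE ANISOTROPIC PLANE IS INTEGRAL** (`ξ` a non-norm unit): `|a|, |b|, |c|, |d| ≤ 1` for `g = (a b; c d) ∈ U(σ, diag(1,−ξ))(K)` — from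
`σa·a − ξσc·c = 1` and `σb·b − ξσd·d = −ξ` (★ `anisoPlane_entry_relations`) and §1. [cite: PlatonovRapinchuk1994, §3.3] [cite: Rogawski1990, §3.8 p. 33] -/
theorem anisoPlane_valued_le_of_unit {g : GL (Fin 2) K} (hg : g ∈ unitaryGroupOfForm σ !![(1 : K), 0; 0, -ξ]) :
    Valued.v (g 0 0 : K) ≤ 1 ∧ Valued.v (g 0 1 : K) ≤ 1 ∧ Valued.v (g 1 0 : K) ≤ 1 ∧ Valued.v (g 1 1 : K) ≤ 1 := by
  obtain ⟨h00, -, h11⟩ := anisoPlane_entry_relations σ ξ hg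
  have m00 := valued_normSub_eq_max_of_unit σ hvσ hξ1 hξN (g 0 0) (g 1 0)
  rw [h00, map_one] at m00
  have m11 := valued_normSub_eq_max_of_unit σ hvσ hξ1 hξN (g 0 1) (g 1 1)
  rw [h11, Valuation.map_neg, hξ1] at m11
  have ha : Valued.v (g 0 0 : K) ^ 2 ≤ 1 := le_of_le_of_eq (le_max_left _ _) m00.symm
  have hc : Valued.v (g 1 0 : K) ^ 2 ≤ 1 := le_of_le_of_eq (le_max_right _ _) m00.symm
  have hb : Valued.v (g 0 1 : K) ^ 2 ≤ 1 := le_of_le_of_eq (le_max_left _ _) m11.symm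
  have hd : Valued.v (g 1 1 : K) ^ 2 ≤ 1 := le_of_le_of_eq (le_max_right _ _) m11.symm
  exact ⟨valued_le_one_of_sq_le_one ha, valued_le_one_of_sq_le_one hb, valued_le_one_of_sq_le_one hc, valued_le_one_of_sq_le_one hd⟩

include hvσ hξ1 hξN in
/-- The inverse of an element of the anisotropic plane is integral too (it lies in the same group). [cite: PlatonovRapinchuk1994, §3.3] -/
theorem anisoPlane_inv_valued_le_of_unit {g : GL (Fin 2) K} (hg : g ∈ unitaryGroupOfForm σ !![(1 : K), 0; 0, -ξ]) :
    Valued.v ((g⁻¹ : GL (Fin 2) K) 0 0 : K) ≤ 1 ∧ Valued.v ((g⁻¹ : GL (Fin 2) K) 0 1 : K) ≤ 1 ∧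
      Valued.v ((g⁻¹ : GL (Fin 2) K) 1 0 : K) ≤ 1 ∧ Valued.v ((g⁻¹ : GL (Fin 2) K) 1 1 : K) ≤ 1 :=
  anisoPlane_valued_le_of_unit σ hvσ hξ1 hξN ((unitaryGroupOfForm σ !![(1 : K), 0; 0, -ξ]).inv_mem hg)

include hvσ hξ1 hξN in
/-- **The diagonal norms are UNITS**: `|σa·a| = 1 ∨ |σc·c| = 1`-type bookkeeping in the sharp form `max(|a|², |c|²) = 1` and `max(|b|², |d|²) = 1` — the reduction of `g` is a
non-zero matrix in each column (the special fibre is `O(⟨1, −ξ̄⟩)`, count in the sequel). [cite: Rogawski1990, §3.8 p. 33] -/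
theorem anisoPlane_max_valued_sq_eq_one_of_unit {g : GL (Fin 2) K} (hg : g ∈ unitaryGroupOfForm σ !![(1 : K), 0; 0, -ξ]) :
    max (Valued.v (g 0 0 : K) ^ 2) (Valued.v (g 1 0 : K) ^ 2) = 1 ∧ max (Valued.v (g 0 1 : K) ^ 2) (Valued.v (g 1 1 : K) ^ 2) = 1 := by
  obtain ⟨h00, -, h11⟩ := anisoPlane_entry_relations σ ξ hg
  have m00 := valued_normSub_eq_max_of_unit σ hvσ hξ1 hξN (g 0 0) (g 1 0)
  rw [h00, map_one] at m00
  have m11 := valued_normSub_eq_max_of_unit σ hvσ hξ1 hξN (g 0 1) (g 1 1)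
  rw [h11, Valuation.map_neg, hξ1] at m11
  exact ⟨m00.symm, m11.symm⟩

end Entries

end UnitaryGroup

end Literature.NumberTheory.Automorphic

end
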